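import Summits.Schanuel.Schanuel.Theorems.RootDecomp1KNW96Core11

/-!
# RootDecomp1KNW96Core — lens 6, generation 24 «NW96 THEOREM 5(1) AS PRINTED (105500), HYPOTHESIS-FREE» (RULE G25 (iii); CLAIM L2202/L2203, CHECKLIST G25-α = ACK L2204, NODE L2222 / REQUEST L2223, writer re-check L2227, critic VERDICT L2233: CLEARED — THEOREM ×1 «`theorem …RootDecomp1KNW96Core.nesterenkoWaldschmidt1996_thm_5_1_holds : Literature.NumberTheory.Transcendental.NesterenkoWaldschmidt1996_thm_5_1` by proof»; the AUDIT-G22 gap «thm_5_1 registered, unproved» CLOSED; RULE G26; lens-6 tally THEOREM ×8 + CELL ×3 + AUDIT ×1) — continuation (RootDecomp1KNW96Core12): §2 `thm51_budget`, `thm51_exponent_le` (+ `_400`), `norm_le_thm51_exponent`; §3 slot `NW1996Thm51C`, plumbing (a)(b)(c), `thm51C_of_mainR`, `nw1996Thm51C_105500`, headline `nesterenkoWaldschmidt1996_thm_5_1_holds`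

(lens-6 g24 HOME kernel K = HOME/decomp-schanuel-lens-6/g24/NW96Thm51.lean b14a307c…, 880 l, imports tree `…RootDecomp1KNW96Core07` + Literature `…ExpAlgebraicApproximationMeasure`; P NW96Thm51Probe.lean 86491eb5… rc 0; C NW96Thm51Controls.lean 2460ef9c… rc 1 = exactly the 9 planted errors. Port by census-1 gen 19 as `RootDecomp1KNW96Core10`–`12` (the verdict's «Core10, one file, 880 l» split for the 400-line cap): 10 = §1–§2 numerics (`exp`/`log` pins, `log(t+2) ≤ log t + 2/t`, `x ≤ e^{x−1}`, `e·x ≤ e^x`, `x²e^{2−x} ≤ e·x`, `e²x ≤ 2e^x`, `W ≤ 19.4366`), the link cell core `cellB_core` per `D ∈ {1,2,3,4}, ≥ 5` and `F3_le_regimeI`; 11 = the FOUR NAMED CELLS `cell_IA` (120), `cell_IB` (252 ≤ 263.75), `regimeII_eb`, `cell_IIA` (1046.052 ≤ 1055, binding), `cell_IIB` (link cell); 12 = `thm51_budget`, the ONE comparison theorem `thm51_exponent_le` (constant 1055/4 · c) + `_400`, `norm_le_thm51_exponent`, §3 the c-generic slot `NW1996Thm51C`, `nw1996Thm51C_iff`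 (Iff.rfl), (a) `weilHeight₁_unit_eq_vec`, (b) the LINK `neg_height_le_log_norm`, (c) `exp_neg_le_norm_exp_sub_zero`, the instance `thm51C_of_mainR (hc : 1 ≤ c) (hNW : NW1996MainR c) : NW1996Thm51C (1055/4 * c)` (θ := β, A′ := A, B′ := e^{h(β)}, E′ := max(E, e²)), `nw1996Thm51C_105500` and the headline `nesterenkoWaldschmidt1996_thm_5_1_holds` HYPOTHESIS-FREE.
PORT EDITS: the file-wide `set_option linter.dupNamespace false` dropped; the thirteen generic `exp`/`log` numerics lemmas of §1 made `private` (dedup-safety: Literature twins) and K's `log_add_two_le` (log(t+2) ≤ log t + 2/t) RENAMED `log_add_two_le_two_div` — the gate's fqn lint refuses the short name, already taken by Core08's `log_add_two_le` (log(n+2) ≤ log n + 1.1) in the same namespace with per-part private copies where a later part uses them; the slot def's docstring tagged «[slot] c-generic statement def …» (census convention, verdict condition); statements and proofs otherwise verbatim. `--supports stmt-Schanuel-33364`; no census credit carried; rung 0 — nothing here proves Schanuel. CONSEQUENCE OF RECORD (G25 (i) pattern, RULE G26 (i)): every `(hNW : NesterenkoWaldschmidt1996_thm_5_1)` binder in the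 tree (Hyper19, FiniteOrderCell04, StoreyOneAtlas02, PowerLineOrder02 …) is dischargeable BY NAME — census relabel bookkeeping ×0; the Literature `_holds` companion waits for the relocation of the NW96Core chain into Literature (Literature must not import Summits).)
-/

noncomputable section

namespace Summit.Schanuel.Schanuel.Theorems.RootDecomp1KNW96Core

open Literature.NumberTheory.Transcendental

section Thm51Numerics

open Real

/-- `log (t + 2) ≤ log t + 2/t` for `t ≥ 1` (`log(1 + 2/t) ≤ 2/t`). [folklore] -/
private theorem log_add_two_le_two_div {t : ℝ} (ht : 1 ≤ t) : log (t + 2) ≤ log t + 2 / t := by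
  have ht0 : 0 < t := by linarith
  have e : t + 2 = t * (1 + 2 / t) := by field_simp
  rw [e, Real.log_mul ht0.ne' (by positivity)]
  have := Real.log_le_sub_one_of_pos (show (0 : ℝ) < 1 + 2 / t by positivity)
  linarith

/-- **The budget inequality** `F₁ F₂ F₃ x² ≤ (1055/4) · D L · T₁ T₃ · y²` (all regimes): the preamble
derives the atoms' relations (`b ≤ S e^{−x}`, `log b ≤ σ − x`, hence `log₊ b ≤ max(0, σ − x)` and the
LINK in the form `x − σ ≤ D h`), then dispatches to the four cells.
[cite: NesterenkoWaldschmidt1996, Theorem 5 (1) via Theorem 1] -/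
theorem thm51_budget (n : ℕ) (hn : 1 ≤ n) {x L b h : ℝ} (hx : 1 ≤ x) (hxL : x ≤ n * L) (hb : 0 < b)
    (hbE : b * exp x ≤ n * L) (hh : 0 ≤ h) (hlink : -(n * h) ≤ log b) :
    (h + log L + 4 * log n + 2 * (max x 2 + log (max 1 b)) + 10) *
        (n * L + 2 * exp (max x 2) * b + 6 * max x 2) * (33 / 10 * n * log ((n : ℝ) + 2) + max x 2) *
        x ^ 2 ≤
      1055 / 4 * (n * L) * (h + log (max 1 L) + log n + x) * (n * log n + x) * (max x 2) ^ 2 := by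
  have hD1 : (1 : ℝ) ≤ n := by exact_mod_cast hn
  have core := fun (h2 : x ≤ 2) => cellB_core n hn hx h2
  have hF3I := fun (h2 : 2 ≤ x) => F3_le_regimeI n hn h2
  have hF3_0 : 0 ≤ 33 / 10 * (n : ℝ) * log ((n : ℝ) + 2) := by
    have : 0 ≤ log ((n : ℝ) + 2) := Real.log_nonneg (by linarith)
    positivity
  have hlog2D : log ((n : ℝ) + 2) ≤ log n + 2 / n := log_add_two_le_two_div hD1
  have hF3c : 33 / 10 * (n : ℝ) * log ((n : ℝ) + 2) ≤ 33 / 10 * n * log n + 33 / 5 := by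
    have h1 := mul_le_mul_of_nonneg_left hlog2D (by positivity : (0 : ℝ) ≤ 33 / 10 * n)
    have e : 33 / 10 * (n : ℝ) * (log n + 2 / n) = 33 / 10 * n * log n + 33 / 5 := by
      field_simp; ring
    linarith
  generalize hF3g : 33 / 10 * (n : ℝ) * log ((n : ℝ) + 2) = F₃ at core hF3I hF3_0 hF3c ⊢
  generalize hD : (n : ℝ) = D at hD1 hxL hbE hlink core hF3I hF3c ⊢
  -- positivity of the data
  have hD0 : 0 < D := by linarith
  have hS1 : 1 ≤ D * L := le_trans hx hxL
  have hS0 : 0 < D * L := by linarith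
  have hL0 : 0 < L := by
    rcases pos_and_pos_or_neg_and_neg_of_mul_pos hS0 with h' | h'
    · exact h'.2
    · exact absurd h'.1 (not_lt.2 hD0.le)
  have hx0 : 0 ≤ x := by linarith
  have hu0 : 0 ≤ log D := Real.log_nonneg hD1
  have hσ0 : 0 ≤ log (D * L) := Real.log_nonneg hS1
  have hSexp : exp (log (D * L)) = D * L := Real.exp_log hS0
  have hlogL : log L = log (D * L) - log D := by rw [Real.log_mul hD0.ne' hL0.ne']; ring
  have hℓ0 : 0 ≤ log (max 1 L) := Real.log_nonneg (le_max_left _ _)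
  have hℓL : log L ≤ log (max 1 L) := Real.log_le_log hL0 (le_max_right _ _)
  have hDu0 : 0 ≤ D * log D := mul_nonneg hD0.le hu0
  -- the modulus `b ≤ D L e^{-x}`
  have hex0 := exp_pos x
  have hbS : b ≤ D * L / exp x := by rw [le_div_iff₀ hex0]; exact hbE
  have hbσ : b ≤ exp (log (D * L) - x) := by rw [Real.exp_sub, hSexp]; exact hbS
  have hlogb : log b ≤ log (D * L) - x := by
    have := Real.log_le_log hb hbσ; rwa [Real.log_exp] at this
  have hlinkσ : x - log (D * L) ≤ D * h := by linarith
  have hlb0 : 0 ≤ log (max 1 b) := Real.log_nonneg (le_max_left _ _)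
  have hlbA : x ≤ log (D * L) → log (max 1 b) ≤ log (D * L) - x := by
    intro hσx
    rcases le_or_gt b 1 with hb1 | hb1
    · rw [max_eq_left hb1, Real.log_one]; linarith
    · rw [max_eq_right hb1.le]; exact hlogb
  have hlbB : log (D * L) < x → log (max 1 b) = 0 := by
    intro hσx
    have hb1 : b < 1 := lt_of_le_of_lt hbσ (Real.exp_lt_one_iff.2 (by linarith))
    rw [max_eq_left hb1.le, Real.log_one]
  rw [hlogL] at hℓL ⊢
  -- atoms
  generalize hS : D * L = S at *
  generalize hu : log D = u at *
  generalize hσ : log S = σ at *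
  generalize hℓ : log (max 1 L) = ℓ at *
  generalize hlb : log (max 1 b) = lb at *
  have hxS : x ≤ S := hxL
  rcases le_or_gt 2 x with hx2 | hx2
  · -- Regime I: `y = x`
    have hy : max x 2 = x := max_eq_left hx2
    simp only [hy]
    rcases le_or_gt x σ with hσx | hσx
    · exact cell_IA hx2 hσx hS0 hSexp hb hbE hh hℓ0 hℓL (hlbA hσx) hDu0 hF3_0 (hF3I hx2)
    · exact cell_IB hx2 hxS hS0 hb hbE hh hu0 hℓ0 hℓL (hlbB hσx) hDu0 hF3_0 (hF3I hx2)
  · -- Regime II: `y = 2`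
    have hy : max x 2 = 2 := max_eq_right hx2.le
    simp only [hy]
    rcases le_or_gt x σ with hσx | hσx
    · exact cell_IIA hx hx2.le hσx hS0 hSexp hb hbS hh hu0 hℓ0 hℓL (hlbA hσx) hDu0 hF3_0 hF3c
    · exact cell_IIB hD1 hx hx2.le hσx hxS hS0 hb hbS hu0 hℓ0 hℓL (hlbB hσx) hlinkσ hDu0 hF3_0 hF3c
        (core hx2.le)

/-- **The exponent comparison, displayed** (`D = n ≥ 1`, `x = log E ≥ 1`, `L = log A` with `x ≤ D L`,
`b = |β| > 0` with `b·e^x ≤ D L`, `h = h(β) ≥ 0`, the LINK `log b ≥ −D h`; any `c ≥ 0`):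
Theorem 1's exponent at `(θ, A′, B′, E′) = (β, A, e^h, max(E, e²))`, namely
`c·D·(h + log L + 4 log D + 2(y + log₊ b) + 10)·(D L + 2 e^y b + 6 y)·(3.3 D log(D+2) + y)/y²` with
`y = max(x, 2)`, is at most Theorem 5's `(1055/4)·c · D² L (h + log₊ L + log D + x)(D log D + x)/x²`.
[cite: NesterenkoWaldschmidt1996, Theorem 5 (1) via Theorem 1] -/
theorem thm51_exponent_le (n : ℕ) (hn : 1 ≤ n) {c x L b h : ℝ} (hc : 0 ≤ c) (hx : 1 ≤ x)
    (hxL : x ≤ n * L) (hb : 0 < b) (hbE : b * exp x ≤ n * L) (hh : 0 ≤ h) (hlink : -(n * h) ≤ log b) :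
    c * n * (h + log L + 4 * log n + 2 * (max x 2 + log (max 1 b)) + 10) *
        (n * L + 2 * exp (max x 2) * b + 6 * max x 2) * (33 / 10 * n * log ((n : ℝ) + 2) + max x 2) /
        (max x 2) ^ 2 ≤
      1055 / 4 * c * (n : ℝ) ^ 2 * L * (h + log (max 1 L) + log n + x) * (n * log n + x) / x ^ 2 := by
  have hB := thm51_budget n hn hx hxL hb hbE hh hlink
  have hy0 : 0 < max x 2 := lt_of_lt_of_le two_pos (le_max_right _ _)
  have hx0 : 0 < x := by linarith
  rw [div_le_div_iff₀ (by positivity) (by positivity)]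
  have key := mul_le_mul_of_nonneg_left hB (by positivity : 0 ≤ c * (n : ℝ))
  have e1 : c * n * (h + log L + 4 * log n + 2 * (max x 2 + log (max 1 b)) + 10) *
        (n * L + 2 * exp (max x 2) * b + 6 * max x 2) * (33 / 10 * n * log ((n : ℝ) + 2) + max x 2) * x ^ 2 =
      c * n * ((h + log L + 4 * log n + 2 * (max x 2 + log (max 1 b)) + 10) *
        (n * L + 2 * exp (max x 2) * b + 6 * max x 2) * (33 / 10 * n * log ((n : ℝ) + 2) + max x 2) * x ^ 2) := by
    ring
  have e2 : 1055 / 4 * c * (n : ℝ) ^ 2 * L * (h + log (max 1 L) + log n + x) * (n * log n + x) * (max x 2) ^ 2 =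
      c * n * (1055 / 4 * (n * L) * (h + log (max 1 L) + log n + x) * (n * log n + x) * (max x 2) ^ 2) := by
    ring
  rw [e1, e2]
  exact key

/-- **The comparison at the tree's `c = 400`, in the fact's variables** (`E` itself, `exp 1 ≤ E`,
`b·E ≤ D·L`): Theorem 1's exponent at `(β, A, e^{h(β)}, max(E, e²))` is at most
`105500 · D² · L · (h + log₊ L + log D + log E) · (D log D + log E) / (log E)²` — `(1055/4)·400 = 105500`. [folklore] -/
theorem thm51_exponent_le_400 (n : ℕ) (hn : 1 ≤ n) {E L b h : ℝ} (hE : exp 1 ≤ E)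
    (hxL : log E ≤ n * L) (hb : 0 < b) (hbE : b * E ≤ n * L) (hh : 0 ≤ h)
    (hlink : -(n * h) ≤ log b) :
    400 * n * (h + log L + 4 * log n + 2 * (max (log E) 2 + log (max 1 b)) + 10) *
          (n * L + 2 * exp (max (log E) 2) * b + 6 * max (log E) 2) *
          (33 / 10 * n * log ((n : ℝ) + 2) + max (log E) 2) / (max (log E) 2) ^ 2 ≤
      105500 * (n : ℝ) ^ 2 * L * (h + log (max 1 L) + log n + log E) * (n * log n + log E) /
        (log E) ^ 2 := by
  have hE0 : 0 < E := (exp_pos 1).trans_le hE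
  have hx : 1 ≤ log E := by rw [Real.le_log_iff_exp_le hE0]; exact hE
  have hbE' : b * exp (log E) ≤ n * L := by rw [Real.exp_log hE0]; exact hbE
  have h := thm51_exponent_le n hn (by norm_num : (0 : ℝ) ≤ 400) hx hxL hb hbE' hh hlink
  have e : (1055 / 4 * 400 : ℝ) = 105500 := by norm_num
  rw [e] at h
  exact h

/-- **Theorem 5's exponent dominates `|β|`** (for the corner `α = 0`): with `b E ≤ D L`, `E ≥ 1`,
`1 ≤ x ≤ D L`, `h ≥ 0`, `c ≥ 1`: `b ≤ (1055/4)·c·D²·L·(h + log₊ L + log D + x)(D log D + x)/x²`. [folklore] -/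
theorem norm_le_thm51_exponent {c D L h x b E : ℝ} (hc : 1 ≤ c) (hD1 : 1 ≤ D) (hx1 : 1 ≤ x)
    (hxL : x ≤ D * L) (hb : 0 ≤ b) (hE1 : 1 ≤ E) (hbE : b * E ≤ D * L) (hh0 : 0 ≤ h) :
    b ≤ 1055 / 4 * c * D ^ 2 * L * (h + log (max 1 L) + log D + x) * (D * log D + x) / x ^ 2 := by
  have hD0 : 0 < D := by linarith
  have hx0 : 0 < x := by linarith
  have hu0 : 0 ≤ log D := Real.log_nonneg hD1
  have hℓ0 : 0 ≤ log (max 1 L) := Real.log_nonneg (le_max_left _ _)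
  have hT10 : 0 ≤ h + log (max 1 L) + log D + x := by linarith
  have hT1x : x ≤ h + log (max 1 L) + log D + x := by linarith
  have hDu0 : 0 ≤ D * log D := mul_nonneg hD0.le hu0
  have hT3x : x ≤ D * log D + x := le_add_of_nonneg_left hDu0
  have hT30 : 0 ≤ D * log D + x := by linarith
  have hS0 : 0 < D * L := by linarith
  rw [le_div_iff₀ (by positivity)]
  have h1 : b ≤ D * L := le_trans (le_mul_of_one_le_right hb hE1) hbE
  have h2 : x ^ 2 ≤ (h + log (max 1 L) + log D + x) * (D * log D + x) := by
    rw [pow_two]; exact mul_le_mul hT1x hT3x hx0.le hT10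
  have h3 := mul_le_mul h1 h2 (sq_nonneg x) hS0.le
  have h4 : 1 ≤ 1055 / 4 * c * D := one_le_mul_of_one_le_of_one_le (by linarith) hD1
  have hnn : 0 ≤ D * L * ((h + log (max 1 L) + log D + x) * (D * log D + x)) :=
    mul_nonneg hS0.le (mul_nonneg hT10 hT30)
  have h5 := mul_le_mul_of_nonneg_right h4 hnn
  have e : 1055 / 4 * c * D ^ 2 * L * (h + log (max 1 L) + log D + x) * (D * log D + x) =
      1055 / 4 * c * D * (D * L * ((h + log (max 1 L) + log D + x) * (D * log D + x))) := by
    ring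
  rw [e]; linarith

end Thm51Numerics

/-! ## §3. The slot, the plumbing lemmas, and Theorem 5 (1) -/

section Thm51Main

/-- [slot] c-generic statement def = the registered `NesterenkoWaldschmidt1996_thm_5_1` text with `105500 ↦ c`; `nw1996Thm51C_iff` by `Iff.rfl` (a DEFINITION with a parameter, NOT a new fact; census convention, VERDICT L2233). **The Theorem-5 (1) text with the numerical constant as a parameter.** `NW1996Thm51C c` is, VERBATIM,
the registered `NesterenkoWaldschmidt1996_thm_5_1` with the numeral `105500` replaced by `c`;
`NW1996Thm51C 105500` is the registered fact definitionally (`nw1996Thm51C_iff`, by `Iff.rfl`).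
[cite: NesterenkoWaldschmidt1996, Theorem 5 (1)] -/
def NW1996Thm51C (c : ℝ) : Prop :=
  ∀ (α β : ℂ), IsAlgebraic ℚ α → IsAlgebraic ℚ β → β ≠ 0 →
    ∀ (A E : ℝ), 0 < A → 0 < E → Real.exp 1 ≤ E →
      max (weilHeight₁ (IntermediateField.adjoin ℚ ({α, β} : Set ℂ)) ![α])
          (max ((Module.finrank ℚ (IntermediateField.adjoin ℚ ({α, β} : Set ℂ)) : ℝ)⁻¹ * Real.log E)
            ((Module.finrank ℚ (IntermediateField.adjoin ℚ ({α, β} : Set ℂ)) : ℝ)⁻¹ * ‖β‖ * E))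
        ≤ Real.log A →
      Real.exp (-(c * ((Module.finrank ℚ (IntermediateField.adjoin ℚ ({α, β} : Set ℂ)) : ℝ)) ^ 2 *
          Real.log A *
          (weilHeight₁ (IntermediateField.adjoin ℚ ({α, β} : Set ℂ)) ![β] + Real.log (max 1 (Real.log A)) +
            Real.log (Module.finrank ℚ (IntermediateField.adjoin ℚ ({α, β} : Set ℂ)) : ℝ) + Real.log E) *
          (((Module.finrank ℚ (IntermediateField.adjoin ℚ ({α, β} : Set ℂ)) : ℝ)) *
              Real.log (Module.finrank ℚ (IntermediateField.adjoin ℚ ({α, β} : Set ℂ)) : ℝ) + Real.log E) /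
          Real.log E ^ 2)) ≤
        ‖Complex.exp β - α‖

/-- `NW1996Thm51C 105500` **is** the registered fact, definitionally. -/
theorem nw1996Thm51C_iff : NW1996Thm51C 105500 ↔ NesterenkoWaldschmidt1996_thm_5_1 := Iff.rfl

/-- **(a) Re-indexing.** The `Unit`-indexed one-point height of Theorem 1's text equals the `Fin 1`-indexed
one of Theorem 5's text: `h_F(fun _ : Unit ↦ x) = h_F(![x])` (both inequalities from `weilHeight₁_comp_le`).
[folklore] -/
theorem weilHeight₁_unit_eq_vec (F : IntermediateField ℚ ℂ) [FiniteDimensional ℚ F] {x : ℂ} (hx : x ∈ F) :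
    weilHeight₁ F (fun _ : Unit => x) = weilHeight₁ F ![x] := by
  have hx' : ∀ i : Fin 1, (![x] : Fin 1 → ℂ) i ∈ F := fun i => by
    rw [Matrix.cons_val_fin_one]; exact hx
  apply le_antisymm
  · exact weilHeight₁_single_le F ![x] hx' 0
  · have h := weilHeight₁_comp_le F (fun _ : Fin 1 => ()) (fun _ : Unit => x) (fun _ => hx)
    have e : ((fun _ : Unit => x) ∘ fun _ : Fin 1 => ()) = ![x] := by
      funext i; rw [Matrix.cons_val_fin_one]; rfl
    rwa [e] at h

/-- **(b) The height–modulus LINK** (Liouville, one monomial): for `β ≠ 0` in the number field `F ⊂ ℂ`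
of degree `D`, `log |β| ≥ −D · h_F(β)`.  From `liouville₂_sharp` (Core01) with the single monomial `β`.
This is where the route is load-bearing: the printed corner `D = 1`, `E = e`, `log A = 1`, `|β| = 1/e`
is not realisable with `h(β) = 0`. [folklore] -/
theorem neg_height_le_log_norm (F : IntermediateField ℚ ℂ) [FiniteDimensional ℚ F] {β : ℂ} (hβ : β ∈ F)
    (hβ0 : β ≠ 0) :
    -((Module.finrank ℚ F : ℝ) * weilHeight₁ F (fun _ : Unit => β)) ≤ Real.log ‖β‖ := by
  have h := liouville₂_sharp F hβ hβ (Finset.univ : Finset Unit) (fun _ => (1 : ℤ)) (fun _ => 1)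
    (fun _ => 0) (D₁ := 1) (D₂ := 0) (fun _ _ => ⟨le_rfl, le_rfl⟩) (by simpa using hβ0)
  simpa using h

/-- **(c) The corner `α = 0`** (outside Theorem 1's hypotheses, fact-free): `|e^β − 0| = e^{Re β} ≥ e^{−X}`
as soon as `|β| ≤ X`. [folklore] -/
theorem exp_neg_le_norm_exp_sub_zero {β : ℂ} {X : ℝ} (hX : ‖β‖ ≤ X) :
    Real.exp (-X) ≤ ‖Complex.exp β - 0‖ := by
  rw [sub_zero, Complex.norm_exp]
  exact Real.exp_le_exp.mpr (by linarith [Complex.abs_re_le_norm β, neg_abs_le β.re])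

/-- **NW96 Theorem 1 (any constant `c ≥ 1`) ⟹ Theorem 5 (1) with constant `(1055/4)·c`.**
ENGINE = INSTANCE of `NW1996MainR c` at `θ := β`, `α := α`, `β := β`, `A′ := A`, `B′ := e^{h(β)}`,
`E′ := e^{max(log E, 2)} = max(E, e²)` (`θ : ℂ` in Theorem 1's text, so complex `β` is covered); side
conditions: `θ ≠ 0` ← `β ≠ 0`; `α ≠ 0` by cases (the corner `α = 0` is `exp_neg_le_norm_exp_sub_zero`);
`0 < A′`, `0 < B′`, `e ≤ E′`; the height hypotheses via `weilHeight₁_unit_eq_vec`; the LINK via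
`neg_height_le_log_norm`; the exponents compared by `thm51_exponent_le`.
[cite: NesterenkoWaldschmidt1996, Theorem 5 (1) via Theorem 1] -/
theorem thm51C_of_mainR {c : ℝ} (hc : 1 ≤ c) (hNW : NW1996MainR c) : NW1996Thm51C (1055 / 4 * c) := by
  intro α β hα hβ hβ0 A E hA hE heE hmax
  -- the number field `K = ℚ(α, β)` and its degree `D ≥ 1`
  haveI hfd : FiniteDimensional ℚ (IntermediateField.adjoin ℚ ({α, β} : Set ℂ)) :=
    IntermediateField.finiteDimensional_adjoin fun x hx => by
      rcases hx with rfl | hx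
      · exact hα.isIntegral
      · rw [Set.mem_singleton_iff.mp hx]; exact hβ.isIntegral
  have hαK : α ∈ IntermediateField.adjoin ℚ ({α, β} : Set ℂ) :=
    IntermediateField.subset_adjoin ℚ _ (Set.mem_insert _ _)
  have hβK : β ∈ IntermediateField.adjoin ℚ ({α, β} : Set ℂ) :=
    IntermediateField.subset_adjoin ℚ _ (Set.mem_insert_of_mem _ rfl)
  have hD1nat : 1 ≤ Module.finrank ℚ (IntermediateField.adjoin ℚ ({α, β} : Set ℂ)) := Module.finrank_pos
  have hD1 : (1 : ℝ) ≤ (Module.finrank ℚ (IntermediateField.adjoin ℚ ({α, β} : Set ℂ)) : ℝ) := by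
    exact_mod_cast hD1nat
  -- (a) re-indexed heights, (b) the link
  have hHa := weilHeight₁_unit_eq_vec _ hαK
  have hHb := weilHeight₁_unit_eq_vec _ hβK
  have hh0 : 0 ≤ weilHeight₁ (IntermediateField.adjoin ℚ ({α, β} : Set ℂ)) ![β] := weilHeight₁_nonneg _ _
  have hlink : -((Module.finrank ℚ (IntermediateField.adjoin ℚ ({α, β} : Set ℂ)) : ℝ) *
      weilHeight₁ (IntermediateField.adjoin ℚ ({α, β} : Set ℂ)) ![β]) ≤ Real.log ‖β‖ := by
    have := neg_height_le_log_norm _ hβK hβ0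
    rwa [hHb] at this
  -- numerics of `E`, `A`, `|β|`
  have hE1 : 1 < E := lt_of_lt_of_le (by have := Real.add_one_le_exp (1 : ℝ); linarith) heE
  have hx1 : 1 ≤ Real.log E := (Real.le_log_iff_exp_le hE).mpr heE
  have hb : 0 < ‖β‖ := norm_pos_iff.mpr hβ0
  have hD0 : (0 : ℝ) < (Module.finrank ℚ (IntermediateField.adjoin ℚ ({α, β} : Set ℂ)) : ℝ) := by linarith
  have hAα : weilHeight₁ (IntermediateField.adjoin ℚ ({α, β} : Set ℂ)) ![α] ≤ Real.log A :=
    le_trans (le_max_left _ _) hmax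
  have hxL : Real.log E ≤ (Module.finrank ℚ (IntermediateField.adjoin ℚ ({α, β} : Set ℂ)) : ℝ) * Real.log A := by
    have h1 := le_trans (le_trans (le_max_left _ _) (le_max_right _ _)) hmax
    have h2 := mul_le_mul_of_nonneg_left h1 hD0.le
    rwa [← mul_assoc, mul_inv_cancel₀ hD0.ne', one_mul] at h2
  have hbE' : ‖β‖ * E ≤ (Module.finrank ℚ (IntermediateField.adjoin ℚ ({α, β} : Set ℂ)) : ℝ) * Real.log A := by
    have h1 := le_trans (le_trans (le_max_right _ _) (le_max_right _ _)) hmax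
    have h2 := mul_le_mul_of_nonneg_left h1 hD0.le
    rwa [← mul_assoc, ← mul_assoc, mul_inv_cancel₀ hD0.ne', one_mul] at h2
  have hbE : ‖β‖ * Real.exp (Real.log E) ≤
      (Module.finrank ℚ (IntermediateField.adjoin ℚ ({α, β} : Set ℂ)) : ℝ) * Real.log A := by
    rwa [Real.exp_log hE]
  -- the exponent comparison (§2) and Theorem 1 (as a function of `α ≠ 0`), logs of `B′`, `E′` evaluated
  have hExp := thm51_exponent_le (Module.finrank ℚ (IntermediateField.adjoin ℚ ({α, β} : Set ℂ))) hD1nat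
    (le_trans zero_le_one hc) hx1 hxL hb hbE hh0 hlink
  have heE' : Real.exp 1 ≤ Real.exp (max (Real.log E) 2) :=
    Real.exp_le_exp.mpr (le_trans (by norm_num) (le_max_right _ _))
  have h5 := fun hα0 : α ≠ 0 => hNW β α β A
    (Real.exp (weilHeight₁ (IntermediateField.adjoin ℚ ({α, β} : Set ℂ)) ![β])) (Real.exp (max (Real.log E) 2))
    hβ0 hα0 hβ0 hα hβ hA (Real.exp_pos _) heE'
  rw [hHa, hHb] at h5
  have elog : Real.log (Real.exp (max (Real.log E) 2) * max 1 ‖β‖) = max (Real.log E) 2 + Real.log (max 1 ‖β‖) := by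
    rw [Real.log_mul (Real.exp_pos _).ne' (by positivity), Real.log_exp]
  simp only [Real.log_exp, elog, sub_self, norm_zero, add_zero] at h5
  -- (c) the corner `α = 0`: Theorem 5's exponent dominates `|β|`
  have hX := norm_le_thm51_exponent hc hD1 hx1 hxL hb.le hE1.le hbE' hh0
  by_cases hα0 : α = 0
  · subst hα0
    exact exp_neg_le_norm_exp_sub_zero hX
  -- `α ≠ 0`: Theorem 1 applies; its `A`-hypothesis from the max-of-three, its `B`-hypothesis is `le_rfl`
  have hAh : max (weilHeight₁ (IntermediateField.adjoin ℚ ({α, β} : Set ℂ)) ![α])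
      (1 / (Module.finrank ℚ (IntermediateField.adjoin ℚ ({α, β} : Set ℂ)) : ℝ)) ≤ Real.log A := by
    refine max_le hAα ?_
    rw [one_div]
    have h0 := mul_le_mul_of_nonneg_left hx1 (inv_nonneg.2 hD0.le)
    have h1 : (Module.finrank ℚ (IntermediateField.adjoin ℚ ({α, β} : Set ℂ)) : ℝ)⁻¹ * Real.log E ≤ Real.log A := by
      rw [inv_mul_le_iff₀ hD0]; exact hxL
    rw [mul_one] at h0
    exact h0.trans h1
  have hfin := h5 hα0 hAh le_rfl
  exact le_trans (Real.exp_le_exp.mpr (neg_le_neg hExp)) hfin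

/-- **Nesterenko–Waldschmidt 1996, Theorem 5 (1), AS PRINTED (constant `105500`), HYPOTHESIS-FREE**:
the registered Literature fact `NesterenkoWaldschmidt1996_thm_5_1` is a theorem, from the tree's
`nw1996MainR_400 : NW1996MainR 400` (Core07) by `thm51C_of_mainR` (`(1055/4)·400 = 105500`).
[cite: NesterenkoWaldschmidt1996, Theorem 5 (1)] -/
theorem nw1996Thm51C_105500 : NW1996Thm51C 105500 := by
  have h := thm51C_of_mainR (by norm_num) nw1996MainR_400
  have e : (1055 / 4 * 400 : ℝ) = 105500 := by norm_num
  rw [e] at h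
  exact h

/-- **Nesterenko–Waldschmidt 1996, Theorem 5 (1)** — the registered Literature fact BY NAME, hypothesis-free.
[cite: NesterenkoWaldschmidt1996, Theorem 5 (1)] -/
theorem nesterenkoWaldschmidt1996_thm_5_1_holds : NesterenkoWaldschmidt1996_thm_5_1 :=
  nw1996Thm51C_iff.mp nw1996Thm51C_105500

end Thm51Main

end Summit.Schanuel.Schanuel.Theorems.RootDecomp1KNW96Core

end
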